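import Literature.NumberTheory.EllipticCurves.ModularSymbolsOrdinaryMeasuresApprox
import HarnessLib

/-!
# Values of the measures of an ordinary eigensymbol on cells, in classical terms

For a `U_p`-eigenfunction `Ψ` of pairs of cusps with values in MEASURES `𝔻⁰_k` (coefficient system
`distCoeffInt`, `p ∣ N`) and unit eigenvalue `u`, the Mazur–Tate–Teitelbaum / Stevens formula for the
restriction of the measure `Ψ(x, y)` to a cell against a monomial:

`∫_{a + pⁿℤ_p} zʲ dΨ(x,y)(z) = u⁻ⁿ · mⱼ(Ψ(β_{a,n}x, β_{a,n}y) | β_{a,n})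
                              = u⁻ⁿ · Σ_{i ≤ j} C(j,i) aʲ⁻ⁱ pⁿⁱ · mᵢ(Ψ(β_{a,n}x, β_{a,n}y))`

(`integral_cellInd_mul_pow`, `integral_cellInd_mul_pow_eq_sum`), `β_{a,n} = (1 a; 0 pⁿ)`.  For `j ≤ k`
the right-hand side only involves the moments of order `≤ k`, i.e. the CLASSICAL weight-`k` symbol
`ρ_k ∘ Ψ`: the measures of an ordinary eigensymbol — in particular the `p`-adic `L`-function measure
`Ψ(0, ∞)` — are computed on `{cells} × {zʲ, j ≤ k}` by classical modular symbols
(Mazur–Tate–Teitelbaum 1986, §I.11–14, "the measure attached to a `p`-ordinary eigensymbol";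
Greenberg–Stevens 1993, (4.6)–(4.8)).  Ingredients: the iterated eigen-relation
`uⁿΨ = Σ_c Ψ|β_{c,n}` (`pow_smul_eq_sum_slash_betaMat`), the push-forward description of the action
of the `β`'s on measures (`integralFn_distρInt_betaMat`) and the moment formula
`PAdicMeasureMomentFiltration.moment_weightActD_upper`.

Brick B3e-E1 of the bottom-up plan recorded with the named fact
`greenbergStevens_kitagawa_twoVariable_interpolation_allBranches`.  Everything is proved; no named facts.

## References

* B. Mazur, J. Tate, J. Teitelbaum, Invent. Math. 84 (1986), §I.11–§I.14. [MazurTateTeitelbaum1986Invent]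
* R. Greenberg, G. Stevens, Invent. Math. 111 (1993), §4, (4.6)–(4.8). [GreenbergStevens1993]
-/

noncomputable section

open scoped MatrixGroups
open Matrix CongruenceSubgroup

namespace Literature.NumberTheory.EllipticCurves

open ModularForms ModularForms.HidaCohomology

variable {p : ℕ} [Fact p.Prime]

/-! ### Integration against a fixed function as a linear form on `𝔻⁰` -/

section IntegralForm

variable (p) in
/-- `μ ↦ ∫ f dμ` as a `ℤ_p`-linear form on `𝔻⁰`, for `f` uniformly continuous. [folklore] -/
def integralFnₗ (f : ℤ_[p] → ℚ_[p]) (hf : UniformContinuous f) : DInt p →ₗ[ℤ_[p]] ℚ_[p] where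
  toFun μ := (ProfiniteTower.padicInt p).integralFn μ.1 f
  map_add' μ ν := ProfiniteTower.integralFn_add μ.2.1 ν.2.1 hf
  map_smul' c μ := by
    rw [RingHom.id_apply, Submodule.coe_smul, show c • (μ.1) = (c : ℚ_[p]) • μ.1 from rfl,
      ProfiniteTower.integralFn_smul (c : ℚ_[p]) μ.2.1 hf, Algebra.smul_def, PadicInt.algebraMap_apply]

/-- Unfolding `integralFnₗ`. [folklore] -/
@[simp] theorem integralFnₗ_apply (f : ℤ_[p] → ℚ_[p]) (hf : UniformContinuous f) (μ : DInt p) :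
    integralFnₗ p f hf μ = (ProfiniteTower.padicInt p).integralFn μ.1 f := rfl

/-- The test functions `1_{a + pⁿℤ_p}(z) · zʲ` are uniformly continuous. [folklore] -/
theorem uniformContinuous_cellInd_mul_pow (n : ℕ) (a : ZMod (p ^ n)) (j : ℕ) :
    UniformContinuous fun z : ℤ_[p] => cellInd (𝕜 := ℚ_[p]) n a z * (z : ℚ_[p]) ^ j :=
  BoundedDistribution.uniformContinuous_mul' (uniformContinuous_cellInd n a) (uniformContinuous_coe_pow j)

end IntegralForm

/-! ### Integration against the push-forward `v|β_{c,n}` -/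

section Pushforward

/-- **`∫ f d(v|β_{c,n}) = ∫ f(c + pⁿz) dv(z)`**: the `β_{c,n}` act on measures by push-forward. [folklore] -/
theorem integralFn_distρInt_betaMat (k n c : ℕ) (v : DInt p) {f : ℤ_[p] → ℚ_[p]} (hf : UniformContinuous f) :
    (ProfiniteTower.padicInt p).integralFn (distρInt p k (betaMat p n c) v).1 f =
      (ProfiniteTower.padicInt p).integralFn v.1 fun z => f ((c : ℤ_[p]) + (p : ℤ_[p]) ^ n * z) := by
  have hM := betaMat_mem_sigma0Set (p := p) p n c
  have hent := norm_entries_of_mem_sigma0Set (dvd_refl p) hM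
  have ha1 : ‖(1 : ℤ_[p])‖ = 1 := norm_one
  rw [distρInt_val_eq_weightActD k (dvd_refl p) hM v,
    weightActD_congr k hent.1 hent.2 ha1 norm_zero_lt_one' (by simp) rfl (by simp) rfl, integralFn_weightActD k ha1 norm_zero_lt_one' _ _ _ hf]
  congr 1
  funext z
  have h := autFactor_mul_moebius ha1 norm_zero_lt_one' ((betaMat p n c 0 1 : ℤ) : ℤ_[p])
    ((betaMat p n c 1 1 : ℤ) : ℤ_[p]) z
  rw [zero_mul, add_zero, one_mul] at h
  rw [h, betaMat_apply01, betaMat_apply11, BoundedDistribution.autPow_apply, zero_mul, add_zero, one_pow, PadicInt.coe_one, map_one,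
    mul_one]
  push_cast
  ring_nf

/-- The test function `1_{a+pⁿℤ_p} zʲ` pulled back along `z ↦ c + pⁿ z` is `[c ≡ a] · (c + pⁿz)ʲ`. [folklore] -/
theorem cellInd_mul_pow_comp_affine (n : ℕ) (a : ZMod (p ^ n)) (j c : ℕ) (z : ℤ_[p]) :
    cellInd (𝕜 := ℚ_[p]) n a ((c : ℤ_[p]) + (p : ℤ_[p]) ^ n * z) * (((c : ℤ_[p]) + (p : ℤ_[p]) ^ n * z : ℤ_[p]) : ℚ_[p]) ^ j =
      if (c : ZMod (p ^ n)) = a then (((c : ℤ_[p]) + (p : ℤ_[p]) ^ n * z : ℤ_[p]) : ℚ_[p]) ^ j else 0 := by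
  rw [cellInd_apply, map_add, toZModPow_pow_mul_eq_zero le_rfl, add_zero, map_natCast]
  split_ifs <;> simp

end Pushforward

/-! ### The formula -/

section Formula

variable [NeZero p] {k N : ℕ} (hpN : p ∣ N) (u : ℤ_[p]ˣ)

/-- **Values of the measures of an ordinary eigensymbol on cells (Mazur–Tate–Teitelbaum; Stevens).**
For `U_p Ψ = u Ψ` with values in `𝔻⁰_k`:
`∫ 1_{a+pⁿℤ_p}(z) zʲ dΨ(x,y)(z) = u⁻ⁿ · mⱼ(Ψ(β_{a,n}x, β_{a,n}y)|β_{a,n})`.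
[cite: MazurTateTeitelbaum1986Invent, §I.11] -/
theorem integral_cellInd_mul_pow {Ψ : P1Q → P1Q → DInt p} (heig : (distCoeffInt p k N hpN).hecke N p Ψ = (u : ℤ_[p]) • Ψ)
    (x y : P1Q) (n : ℕ) (a : ZMod (p ^ n)) (j : ℕ) :
    (ProfiniteTower.padicInt p).integralFn (Ψ x y).1 (fun z => cellInd (𝕜 := ℚ_[p]) n a z * (z : ℚ_[p]) ^ j) =
      (((u⁻¹ : ℤ_[p]ˣ) : ℤ_[p]) : ℚ_[p]) ^ n *
        moment (distρInt p k (betaMat p n a.val) (Ψ (P1Q.act (betaMat p n a.val) x) (P1Q.act (betaMat p n a.val) y))).1 j := by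
  haveI : NeZero (p ^ n) := ⟨pow_ne_zero _ (NeZero.ne p)⟩
  set f : ℤ_[p] → ℚ_[p] := fun z => cellInd (𝕜 := ℚ_[p]) n a z * (z : ℚ_[p]) ^ j with hf
  have hfu : UniformContinuous f := uniformContinuous_cellInd_mul_pow n a j
  -- the iterated eigen-relation at `(x, y)`, integrated against `f`
  have hit := congrFun (congrFun (pow_smul_eq_sum_slash_betaMat hpN u (distCoeffInt p k N hpN) heig n) x) y
  rw [Pi.smul_apply, Pi.smul_apply, Finset.sum_apply, Finset.sum_apply] at hit
  have hI := congrArg (integralFnₗ p f hfu) hit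
  rw [map_smul, map_sum] at hI
  simp only [integralFnₗ_apply, CoeffActionOn.slash_apply, distCoeffInt_ρ] at hI
  -- each term is a push-forward; only `c = a` survives
  have hterm : ∀ c : ZMod (p ^ n), (ProfiniteTower.padicInt p).integralFn
      (distρInt p k (betaMat p n c.val) (Ψ (P1Q.act (betaMat p n c.val) x) (P1Q.act (betaMat p n c.val) y))).1 f =
      if c = a then moment (distρInt p k (betaMat p n a.val) (Ψ (P1Q.act (betaMat p n a.val) x) (P1Q.act (betaMat p n a.val) y))).1 j
        else 0 := by
    intro c
    rw [integralFn_distρInt_betaMat k n c.val _ hfu]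
    simp only [hf]
    simp_rw [cellInd_mul_pow_comp_affine n a j c.val, ZMod.natCast_zmod_val]
    split_ifs with hc
    · subst hc
      rw [moment_def, integralFn_distρInt_betaMat k n c.val _ (uniformContinuous_coe_pow j)]
    · have h0 := (ProfiniteTower.toBounded (Ψ (P1Q.act (betaMat p n c.val) x) (P1Q.act (betaMat p n c.val) y)).2.1).integral_const_mul
        0 (uniformContinuous_coe_pow (p := p) 0)
      simp only [zero_mul] at h0
      exact h0
  simp_rw [hterm] at hI
  rw [Finset.sum_ite_eq' Finset.univ a, if_pos (Finset.mem_univ a)] at hI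
  -- divide by `uⁿ`
  have hinv : (((u⁻¹ : ℤ_[p]ˣ) : ℤ_[p]) : ℚ_[p]) ^ n * (((u : ℤ_[p]) ^ n : ℤ_[p]) : ℚ_[p]) = 1 := by
    rw [PadicInt.coe_pow, ← mul_pow, ← PadicInt.coe_mul, Units.inv_mul, PadicInt.coe_one, one_pow]
  rw [← hI, Algebra.smul_def, PadicInt.algebraMap_apply, ← mul_assoc, hinv, one_mul]

/-- **The same formula, expanded**: `∫ 1_{a+pⁿℤ_p} zʲ dΨ(x,y) = u⁻ⁿ Σ_{i≤j} C(j,i) aʲ⁻ⁱ pⁿⁱ mᵢ(Ψ(β_{a,n}x, β_{a,n}y))`;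
for `j ≤ k` the right-hand side is CLASSICAL (moments of order `≤ k`).
[cite: MazurTateTeitelbaum1986Invent, §I.14] -/
theorem integral_cellInd_mul_pow_eq_sum {Ψ : P1Q → P1Q → DInt p} (heig : (distCoeffInt p k N hpN).hecke N p Ψ = (u : ℤ_[p]) • Ψ)
    (x y : P1Q) (n : ℕ) (a : ZMod (p ^ n)) (j : ℕ) :
    (ProfiniteTower.padicInt p).integralFn (Ψ x y).1 (fun z => cellInd (𝕜 := ℚ_[p]) n a z * (z : ℚ_[p]) ^ j) =
      (((u⁻¹ : ℤ_[p]ˣ) : ℤ_[p]) : ℚ_[p]) ^ n *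
        ∑ i ∈ Finset.range (j + 1), ((j.choose i : ℕ) : ℚ_[p]) * ((a.val : ℕ) : ℚ_[p]) ^ (j - i) * ((p : ℚ_[p]) ^ n) ^ i *
          moment (Ψ (P1Q.act (betaMat p n a.val) x) (P1Q.act (betaMat p n a.val) y)).1 i := by
  rw [integral_cellInd_mul_pow hpN u heig x y n a j]
  congr 1
  set v := Ψ (P1Q.act (betaMat p n a.val) x) (P1Q.act (betaMat p n a.val) y) with hv
  have hM := betaMat_mem_sigma0Set (p := p) p n a.val
  have hent := norm_entries_of_mem_sigma0Set (dvd_refl p) hM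
  have ha1 : ‖(1 : ℤ_[p])‖ = 1 := norm_one
  rw [distρInt_val_eq_weightActD k (dvd_refl p) hM v,
    weightActD_congr k hent.1 hent.2 ha1 norm_zero_lt_one' (by simp) rfl (by simp) rfl, moment_weightActD_upper k j ha1]
  rw [PadicInt.coe_one, inv_one, one_pow, one_pow, one_mul, one_mul]
  refine Finset.sum_congr rfl fun i _ => ?_
  simp only [betaMat_apply01, betaMat_apply11, Int.cast_natCast, Int.cast_pow, PadicInt.coe_natCast, PadicInt.coe_pow]
  rfl

end Formula

/-! ### The `p`-adic `L`-function measure `Ψ(0, ∞)` -/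

section LMeasure

/-- `β_{b,n}` fixes the cusp `∞`. [folklore] -/
theorem betaMat_act_infty (n b : ℕ) : P1Q.act (betaMat p n b) P1Q.infty = P1Q.infty :=
  P1Q.mat2_act_infty_of_eq_zero (a := 1) (b := (b : ℤ)) (d := (p : ℤ) ^ n)
    (by rw [mul_zero, sub_zero, one_mul]; exact pow_ne_zero _ (by exact_mod_cast (Fact.out : p.Prime).ne_zero))

/-- `β_{b,n} · 0 = b / pⁿ`. [folklore] -/
theorem betaMat_act_ofRat_zero (n b : ℕ) : P1Q.act (betaMat p n b) (P1Q.ofRat 0) = P1Q.ofRat ((b : ℚ) / (p : ℚ) ^ n) := by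
  have hd : ((p : ℤ) ^ n) ≠ 0 := pow_ne_zero _ (by exact_mod_cast (Fact.out : p.Prime).ne_zero)
  have h := P1Q.mat2_act_zero (a := 1) (b := (b : ℤ)) (c := 0) (d := (p : ℤ) ^ n) (by rw [mul_zero, sub_zero, one_mul]; exact hd) hd
  rw [show betaMat p n b = P1Q.mat2 1 (b : ℤ) 0 ((p : ℤ) ^ n) from rfl, h]
  push_cast
  rfl

variable [NeZero p] {k N : ℕ} (hpN : p ∣ N) (u : ℤ_[p]ˣ)

/-- **The `p`-adic `L`-function measure of an ordinary eigensymbol in classical terms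
(Mazur–Tate–Teitelbaum).**  For `U_p Ψ = u Ψ` with values in `𝔻⁰_k` and `μ = Ψ(0, ∞)`:
`∫ 1_{a+pⁿℤ_p}(z) zʲ dμ(z) = u⁻ⁿ Σ_{i ≤ j} C(j,i) aʲ⁻ⁱ pⁿⁱ · mᵢ(Ψ(a/pⁿ, ∞))` — for `j ≤ k` the values
of the weight-`k` modular symbols `{a/pⁿ → ∞}` of the classical eigensymbol `ρ_k Ψ`.
[cite: MazurTateTeitelbaum1986Invent, §I.14] -/
theorem integral_cellInd_mul_pow_zero_infty {Ψ : P1Q → P1Q → DInt p} (heig : (distCoeffInt p k N hpN).hecke N p Ψ = (u : ℤ_[p]) • Ψ)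
    (n : ℕ) (a : ZMod (p ^ n)) (j : ℕ) :
    (ProfiniteTower.padicInt p).integralFn (Ψ (P1Q.ofRat 0) P1Q.infty).1 (fun z => cellInd (𝕜 := ℚ_[p]) n a z * (z : ℚ_[p]) ^ j) =
      (((u⁻¹ : ℤ_[p]ˣ) : ℤ_[p]) : ℚ_[p]) ^ n *
        ∑ i ∈ Finset.range (j + 1), ((j.choose i : ℕ) : ℚ_[p]) * ((a.val : ℕ) : ℚ_[p]) ^ (j - i) * ((p : ℚ_[p]) ^ n) ^ i *
          moment (Ψ (P1Q.ofRat ((a.val : ℚ) / (p : ℚ) ^ n)) P1Q.infty).1 i := by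
  rw [integral_cellInd_mul_pow_eq_sum hpN u heig, betaMat_act_ofRat_zero, betaMat_act_infty]

end LMeasure

end Literature.NumberTheory.EllipticCurves

end
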